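/-
Copyright (c) 2026 the pub-hodgecm-mathlib formalisation cell (harness21).  Prover seat hodgecm-mathlib-LH4-p11 (g11), req620 Track A «(D-RAM) FOUR-FRAME» squad
(STAGE-1b, row (2) of the piece `f_{T₊}`, the (β₂) road (R-36), the K6 road; K6 desk LH4-p16 (g3) WORD #9 (b) «p11: Q2 THE BOUNDARY SHELL», FILE B (two fields):
the class read on the boundary shell and the `(q − 2) : q` split in the digit currency; SIG `F0/P3c/LH4/LH4-p11/g11/SIG-Q2.v1.LH4p11g11.md`, desk WORD #12 (a) «=»), 2026-09-05.
-/
import Summits.HodgeConjecture.HodgeConjecture.Theorems.F0P3cDyRamConductorShellInversionCount   -- ★ (this seat, Q2 FILE A): `two_mul_card_filter_normSign_oneAdd_div_eq`, `normSign_eq_neg_one_of_ne_one`; brings ★ (d″-T), ★ K6-(g), ★ Lit conductor toolkit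
import Summits.HodgeConjecture.HodgeConjecture.Theorems.F0P3cDyRamRowCellDigitClassSplit          -- ★ p864480 (LH7-p08 (g3), (d′)): `classClause_iff_not_classClause`, `normRho_mul_normTheta_lineDisc_eq_neg_one`, `map_lineDisc_eq_neg`; brings ★ p863859 `fixedNorm_mul ∕ _mul_iff ∕ _map_iff`
import HarnessLib

/-!
# Crux `H413`, line LH4 «(D-RAM) FOUR-FRAME» — STAGE-1b, row (2), the (β₂) road (R-36), K6-(d″) Q2, FILE B: «THE BOUNDARY SHELL» — on the boundary cell `i = d − 1` of the
# live row's digit line the hyperbolic literal's class conjunct reads `ω(1 + A₀∕V) = 1` (`A₀` the pulled-back slope `(κ₀ − ρκ₀)∕ξ₀`), so by FILE A the boundary shell's digits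
# split `(q − 2) : q` between the two literals — the `hLBd` letters of ★ `…UniformDensityFromTables`

Cell `hodgecm-mathlib` (D-0151), FLOOR 0, crux item H413 = `stmt-HodgeConjecture-24833`, route of record `HCCMUnconditional`; squad F0∕P3c∕LH4; lane
`--supports stmt-HodgeConjecture-24833 --as helper` (count-neutral; pays NO tier-0 row).  THEOREMS ONLY (no `def`, no instance, no notation, no `sorry`, default heartbeats);
★-only imports; states NO law; (β₂) stays a HYPOTHESIS.  Two-field letters as in ★ p864480 (`jE : E → M`, `Fix ρ = jE(E)`, `Θ∘jE = jE∘σ`; `ρ` an isometric involution commuting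
with `Θ`; the wild datum `IsRamifiedQuadraticDatum σ ϖ d tE` on the complete `E`); the CLASS conjunct of ★ p863983's literal predicate for a frame scalar `h_t`:
`CLASS_{h_t}(V) :≡ ∃ e : M, ρ e = e ∧ e * Θ e = (κ₀ + jE V·ξ₀)·ρ(κ₀ + jE V·ξ₀) ∕ (h_t·ρ h_t)`.

WHAT (K6 desk LH4-p16 (g3) WORD #9 (b), WORD #12 (a) «=»; LH7-p08 (g3) (d″-Q) census 02:14:31Z «BOUNDARY `i = d − 1`: affine regime»).  In the row's ONE chart (★ p864361 §7: `κ₀` of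
`ρ`-trace one, `Θ`-fixed, `|κ₀| = 1`; `ξ₀` `ρ`-anti, `Θ`-fixed, `|ξ₀| = exp 2N`) the BOUNDARY cell `b + 2(d − 1)` is the digit shell `|V|·|ξ₀| = exp(2d − 2)`, i.e. `|V| = |ϖ|^{2t}` with
`t + (d − 1) = N`.  THIS FILE:
* §1 `exists_slope`, `slope_letters` — the PULLED-BACK SLOPE `A₀ : E` with `jE A₀·ξ₀ = κ₀ − ρκ₀` exists (the quotient is doubly fixed), is `σ`-fixed, and has `|A₀|·|ξ₀| = 1` (`|2| < 1`:
  `κ₀ − ρκ₀ = 2κ₀ − 1` is a unit), so `|A₀| = |ϖ|^{2N}` in the top chart (`v_slope_eq`).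
* §2 HEAD `classClause_iff_normSign_of_boundary` — on the boundary shell, **`CLASS_h(V₀) ↔ ω(1 + A₀∕V₀) = 1`** for the HYPERBOLIC line model `(φ, h)` (only `hρh·ΔΘΔ = −1`, ★ p864480
  §2, is used).  Mechanism = ★ (d′2) `classClause_of_far` ONE SHELL LOWER: `κρκ = −W²·u` (`W = jE V₀·ξ₀`, `|W| = exp(2d − 2)`), `u = 1 + (κ₀ − ρκ₀)∕W − κ₀ρκ₀∕W²` with
  `(κ₀ − ρκ₀)∕W = jE(A₀∕V₀)` and `|κ₀ρκ₀∕W²| = exp(−(4d − 4)) ≤ |ϖ|^{2d−1}` (`d ≥ 2`) — so `ω(u) = ω(1 + A₀∕V₀)` by ★ Lit `normSign_eq_of_near` —, and `κρκ∕(hρh) = u·N_Θ(jE V₀)·N_Θ(ξ₀Δ)`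
  with two members of `𝒩` (★ `fixedNorm_mul_iff`, ★ `fixedNorm_map_iff`).
* §3 `two_mul_card_filter_class_boundary` — THE `(q − 2) : q` SPLIT IN THE DIGIT CURRENCY: for the ONE chart's digit system `Rd` (σ-fixed integral representatives modulo `|ϖ|^n`,
  `hRd1 hRd2 hRd3`), the shell `t + (d − 1) = N` and the floor `2d + 4t ≤ n + 2N` (⊆ (d″-T)'s `2N + 1 ≤ n`):
  **`2(q − 1)·#((Rd.filter (|V| = |ϖ|^{2t})).filter CLASS_h) = (q − 2)·#(Rd.filter (|V| = |ϖ|^{2t}))`**, and with the CORE frame of ★ `classClause_iff_not_classClause` (the A-literal's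
  line model `(φ′, h′)` of `diagonal dg`, the frame equation, `η ∉ N(E^×)`) the twin **`2(q − 1)·#(… CLASS_{h′}) = q·#(…)`** (`two_mul_card_filter_class'_boundary`); `hLBd_of_boundary` —
  the DRESS in ★ p864447's letter shape: `#shell = (q − 1)·T ⊢ 2·L_H = (q − 2)·T ∧ 2·L_A = q·T` (`T := q^{d−2}·β` by ★ (d″-T) `card_filter_shell_eq_mul_card_ball`).
WHAT IS NOT CLAIMED: the inner shells (LH7-p08 (g3) Q1 ★ p864536, the class-flipping twist), the diagonal (Q3), the far shells (★ (d′2)), ‹BDIG› (the label functional on this shell —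
census next), any census identity.
HONEST LABEL.  Count-neutral field algebra; nothing printed is asserted; no census law is stated; `HC_CM` is proved only modulo the 7 printed citations (2 remaining named inputs:
hLiu418 = `stmt-HodgeConjecture-24832`, h413 = `stmt-HodgeConjecture-24833`) until rung 0 closes.
## References
* [Serre1979] J.-P. Serre, *Local Fields*, GTM 67 (1979): Ch. V §3 Prop. 5, Cor. 2–3 pp. 84–86 (norm index two; norms near `1`), Ch. XV §2 (conductor), Ch. IV §2 Prop. 6.
* [Jacobowitz1962] R. Jacobowitz, *Hermitian forms over local fields*, Amer. J. Math. 84 (1962): §3 (the discriminant class; hyperbolic iff `−det ∈ N`).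
* [Flicker1998UnitaryFL] Y. Z. Flicker, *Elementary proof of the fundamental lemma for a unitary group*, Canad. J. Math. 50 (1998): Prop. 7 p. 84 (type RamK census by classes).
* [Kottwitz1986BaseChangeUnits] R. E. Kottwitz, *Base change for unit elements of Hecke algebras*, Compositio Math. 60 (1986): §1 pp. 240–241 (fixed-lattice counts as orbital integrals).
-/

set_option autoImplicit false

noncomputable section

namespace Summit.HodgeConjecture.HodgeConjecture.Cruxes.H413.F0P3cDyRamRowCellDigitClassBoundary

open scoped Valued WithZero Matrix MatrixGroups
open WithZero Finset
open Literature.NumberTheory.Automorphic Literature.NumberTheory.Automorphic.UnitaryGroup Literature.NumberTheory.Automorphic.UnitaryLatticeTree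
open Literature.NumberTheory.Automorphic.UnitaryThreeFourFrame (IsRamifiedQuadraticDatum normSign)
open Literature.NumberTheory.LocalFields.WildQuadraticDatum (v_varpi_pow normSign_eq_of_near)
open Summit.HodgeConjecture.HodgeConjecture.Cruxes.H413.F0P3cDyRamRowVertexPopulationRead (fixedNorm_mul fixedNorm_mul_iff fixedNorm_map_iff)
open Summit.HodgeConjecture.HodgeConjecture.Cruxes.H413.F0P3cDyRamRowCellDigitClassSplit (classClause_iff_not_classClause normRho_mul_normTheta_lineDisc_eq_neg_one map_lineDisc_eq_neg)
open Summit.HodgeConjecture.HodgeConjecture.Cruxes.H413.F0P3cDyRamConductorShellInversionCount (two_mul_card_filter_normSign_oneAdd_div_eq normSign_eq_neg_one_of_ne_one)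

variable {E M : Type} [Field E] [Valued E ℤᵐ⁰] [Field M] [Valued M ℤᵐ⁰] {ρ Θ : M →+* M}

/-! ## §1 The pulled-back slope `A₀ = (κ₀ − ρκ₀) ∕ ξ₀ ∈ jE(E)` -/

omit [Valued E ℤᵐ⁰] [Valued M ℤᵐ⁰] in
/-- **THE SLOPE EXISTS IN `E`**: for `ρξ₀ = −ξ₀ ≠ 0` and any `κ₀`, the quotient `(κ₀ − ρκ₀) ∕ ξ₀` is `ρ`-fixed (anti over anti), hence `= jE A₀` (`Fix ρ = jE(E)`):
`∃ A₀, jE A₀·ξ₀ = κ₀ − ρκ₀`. [cite: Serre1979, Ch. V §3] -/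
theorem exists_slope (jE : E →+* M) (hjfix : ∀ z, ρ z = z ↔ ∃ c, jE c = z) (hρρ : ∀ x, ρ (ρ x) = x)
    {κ₀ ξ₀ : M} (hξ : ρ ξ₀ = -ξ₀) (hξ0 : ξ₀ ≠ 0) : ∃ A₀ : E, jE A₀ * ξ₀ = κ₀ - ρ κ₀ := by
  have hρq : ρ ((κ₀ - ρ κ₀) / ξ₀) = (κ₀ - ρ κ₀) / ξ₀ := by
    rw [map_div₀, map_sub, hρρ, hξ, ← neg_sub, neg_div_neg_eq]
  obtain ⟨A₀, hA₀⟩ := (hjfix _).1 hρq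
  exact ⟨A₀, by rw [hA₀, div_mul_cancel₀ _ hξ0]⟩

/-- **THE SLOPE LETTERS**: `jE`-letters (`Θ∘jE = jE∘σ`, `|jE a| = |a|`), `Θρ = ρΘ`; `κ₀ + ρκ₀ = 1`, `Θκ₀ = κ₀`, `|κ₀| = 1`; `Θξ₀ = ξ₀ ≠ 0`; `|2| < 1` on `E`; a slope
`jE A₀·ξ₀ = κ₀ − ρκ₀`.  THEN `σA₀ = A₀` and `|A₀|·|ξ₀| = 1` (`κ₀ − ρκ₀ = 2κ₀ − 1` is a unit). [cite: Serre1979, Ch. V §3 Prop. 5, Cor. 2–3 pp. 84–86] -/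
theorem slope_letters {σ : E →+* E} (jE : E →+* M) (hΘj : ∀ c, Θ (jE c) = jE (σ c)) (hjiso : ∀ a, Valued.v (jE a) = Valued.v a)
    (hΘρ : ∀ x, Θ (ρ x) = ρ (Θ x)) (h2v : Valued.v (2 : E) < 1)
    {κ₀ ξ₀ : M} (hκ₀ : κ₀ + ρ κ₀ = 1) (hΘκ₀ : Θ κ₀ = κ₀) (hκ₀1 : Valued.v κ₀ = 1) (hΘξ : Θ ξ₀ = ξ₀) (hξ0 : ξ₀ ≠ 0)
    {A₀ : E} (hA₀ : jE A₀ * ξ₀ = κ₀ - ρ κ₀) : σ A₀ = A₀ ∧ Valued.v A₀ * Valued.v ξ₀ = 1 := by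
  refine ⟨jE.injective ?_, ?_⟩
  · rw [← hΘj]
    have h1 : Θ (jE A₀ * ξ₀) = jE A₀ * ξ₀ := by rw [hA₀, map_sub, hΘρ, hΘκ₀]
    rw [map_mul, hΘξ] at h1
    exact mul_right_cancel₀ hξ0 h1
  · rw [← hjiso, ← Valuation.map_mul, hA₀, show κ₀ - ρ κ₀ = -1 + 2 * κ₀ by linear_combination -hκ₀]
    have hlt : Valued.v (2 * κ₀) < Valued.v (-1 : M) := by
      rw [Valuation.map_neg, Valuation.map_one, Valuation.map_mul, hκ₀1, mul_one, show (2 : M) = jE 2 from (map_ofNat jE 2).symm, hjiso]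
      exact h2v
    rw [Valuation.map_add_eq_of_lt_left _ hlt, Valuation.map_neg, Valuation.map_one]

/-- **THE SLOPE IN THE TOP CHART**: with `|ξ₀| = exp 2N` (and `|ϖ| = exp(−1)`), `|A₀|·|ξ₀| = 1` reads `|A₀| = |ϖ|^{2N}` — FILE A's `hA₀` letter at `a := N`. [cite: Serre1979, Ch. II §1] -/
theorem v_slope_eq {ϖ : E} (hϖ : Valued.v ϖ = exp (-1 : ℤ)) {ξ₀ : M} {N : ℕ} (hξN : Valued.v ξ₀ = exp (2 * (N : ℤ))) {A₀ : E}
    (h : Valued.v A₀ * Valued.v ξ₀ = 1) : Valued.v A₀ = Valued.v ϖ ^ (2 * N) := by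
  rw [v_varpi_pow hϖ, show Valued.v A₀ = (Valued.v ξ₀)⁻¹ from eq_inv_of_mul_eq_one_left h, hξN, ← exp_neg]
  norm_cast

/-! ## §2 HEAD — the class read on the boundary shell -/

omit [Valued E ℤᵐ⁰] [Field M] [Valued M ℤᵐ⁰] in
/-- `ω(x) = 1` iff `x` is a norm (the definition of `normSign`, `1 ≠ −1`). [cite: Serre1979, Ch. V §3 Prop. 5, Cor. 2–3 pp. 84–86] -/
theorem normSign_eq_one_iff {σ : E →+* E} (x : E) : normSign σ x = 1 ↔ ∃ z : E, z * σ z = x := by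
  unfold normSign
  by_cases hx : ∃ z : E, z * σ z = x
  · rw [if_pos hx]; exact ⟨fun _ => hx, fun _ => rfl⟩
  · rw [if_neg hx]; exact ⟨fun h => absurd h (by norm_num), fun h => absurd h hx⟩

/-- **HEAD — «ON THE BOUNDARY SHELL THE HYPERBOLIC CLASS READS `ω(1 + A₀∕V) = 1`».**  `jE`-letters on a complete `E` with the wild datum `IsRamifiedQuadraticDatum σ ϖ d tE`, `2 ≤ d`;
`ρ` an isometric involution commuting with `Θ`; the HYPERBOLIC line model `(φ, h)` of `(StdForm.antidiagonal 2).over E` (`hform`); the chart `Θκ₀ = κ₀`, `|κ₀| = 1` (its trace is not used),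
`ρξ₀ = −ξ₀`, `Θξ₀ = ξ₀`; the slope `jE A₀·ξ₀ = κ₀ − ρκ₀`; a `σ`-fixed digit `V₀` ON THE BOUNDARY SHELL `|V₀|·|ξ₀| = exp(2d − 2)`.  THEN
**`(∃ e, ρe = e ∧ eΘe = κρκ ∕ (hρh)) ↔ normSign σ (1 + A₀ ∕ V₀) = 1`**, `κ = κ₀ + jE V₀·ξ₀`.
[cite: Serre1979, Ch. V §3 Prop. 5, Cor. 2–3 pp. 84–86; Ch. XV §2] [cite: Jacobowitz1962, §3] [cite: Flicker1998UnitaryFL, Prop. 7 p. 84] -/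
theorem classClause_iff_normSign_of_boundary [CompleteSpace E] {σ : E →+* E} {ϖ : E} {d tE : ℕ} (hD : IsRamifiedQuadraticDatum σ ϖ d tE) (hd : 2 ≤ d)
    (jE : E →+* M) (hjfix : ∀ z, ρ z = z ↔ ∃ c, jE c = z) (hΘj : ∀ c, Θ (jE c) = jE (σ c)) (hjiso : ∀ a, Valued.v (jE a) = Valued.v a)
    (hρρ : ∀ x, ρ (ρ x) = x) (hvρ : ∀ x, Valued.v (ρ x) = Valued.v x) (hΘρ : ∀ x, Θ (ρ x) = ρ (Θ x))
    (φ : (Fin 2 → E) →+ M) {h : M} (hform : ∀ x y, jE (pairing σ ((StdForm.antidiagonal 2).over E) x y) = h * Θ (φ x) * φ y + ρ (h * Θ (φ x) * φ y))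
    {κ₀ ξ₀ : M} (hΘκ₀ : Θ κ₀ = κ₀) (hκ₀1 : Valued.v κ₀ = 1) (hξ : ρ ξ₀ = -ξ₀) (hΘξ : Θ ξ₀ = ξ₀)
    {A₀ : E} (hA₀ : jE A₀ * ξ₀ = κ₀ - ρ κ₀)
    {V₀ : E} (hσV₀ : σ V₀ = V₀) (hbd : Valued.v V₀ * Valued.v ξ₀ = exp (2 * (d : ℤ) - 2)) :
    (∃ e : M, ρ e = e ∧ e * Θ e = (κ₀ + jE V₀ * ξ₀) * ρ (κ₀ + jE V₀ * ξ₀) / (h * ρ h)) ↔ normSign σ (1 + A₀ / V₀) = 1 := by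
  obtain ⟨-, -, hϖ, -, -, -, -⟩ := id hD
  have hρj : ∀ c : E, ρ (jE c) = jE c := fun c => (hjfix _).2 ⟨c, rfl⟩
  set W : M := jE V₀ * ξ₀ with hWdef
  have hρW : ρ W = -W := by rw [hWdef, map_mul, hρj, hξ, mul_neg]
  have hΘW : Θ W = W := by rw [hWdef, map_mul, hΘj, hσV₀, hΘξ]
  -- sizes: `|W| = exp(2d − 2) > 1`
  have hWv : Valued.v W = exp (2 * (d : ℤ) - 2) := by rw [hWdef, Valuation.map_mul, hjiso, hbd]
  have hW1 : 1 < Valued.v W := by rw [hWv, ← exp_zero, exp_lt_exp]; omega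
  have hW0 : W ≠ 0 := fun h0 => by rw [h0, Valuation.map_zero] at hW1; exact not_lt.2 zero_le hW1
  have hV0 : V₀ ≠ 0 := fun h0 => hW0 (by rw [hWdef, h0, map_zero, zero_mul])
  have hξ0 : ξ₀ ≠ 0 := fun h0 => hW0 (by rw [hWdef, h0, mul_zero])
  have hjV0 : jE V₀ ≠ 0 := (map_ne_zero jE).2 hV0
  -- the unit `u := −κρκ ∕ W²` and its head `u₁ := 1 + jE(A₀∕V₀)`
  set κ : M := κ₀ + W with hκdef
  have hρκ : ρ κ = ρ κ₀ - W := by rw [hκdef, map_add, hρW]; ring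
  set u : M := -(κ * ρ κ) / (W * W) with hudef
  have hW2 : W * W ≠ 0 := mul_ne_zero hW0 hW0
  have hquot : (κ₀ - ρ κ₀) / W = jE (A₀ / V₀) := by
    rw [map_div₀, eq_div_iff hjV0, div_mul_eq_mul_div, div_eq_iff hW0, ← hA₀, hWdef]; ring
  have hdiff : u - jE (1 + A₀ / V₀) = -(κ₀ * ρ κ₀) / (W * W) := by
    rw [map_add, map_one, ← hquot, hudef, hρκ, hκdef]
    field_simp
    ring
  -- `|u − u₁| = exp(−(4d − 4)) ≤ |ϖE|^{2d−1}`
  have hnearM : Valued.v (u - jE (1 + A₀ / V₀)) ≤ Valued.v (jE ϖ) ^ (2 * d - 1) := by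
    rw [hdiff, map_div₀, Valuation.map_neg, Valuation.map_mul, Valuation.map_mul, hvρ, hκ₀1, one_mul, hWv, ← exp_add, one_div, ← exp_neg,
      hjiso, v_varpi_pow hϖ, exp_le_exp]
    omega
  -- `u` is doubly fixed: `u = jE uE`, `σ uE = uE`
  have hρu : ρ u = u := by
    rw [hudef, map_div₀, map_neg, map_mul, map_mul, hρρ, hρW, mul_comm (ρ κ) κ, neg_mul_neg]
  have hΘκ : Θ κ = κ := by rw [hκdef, map_add, hΘκ₀, hΘW]
  have hΘu : Θ u = u := by rw [hudef, map_div₀, map_neg, map_mul, map_mul, hΘκ, hΘρ, hΘκ, hΘW]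
  obtain ⟨uE, huE⟩ := (hjfix u).1 hρu
  have hσuE : σ uE = uE := jE.injective (by rw [← hΘj, huE, hΘu])
  -- the slope is `σ`-fixed, so `1 + A₀∕V₀` is fixed and a unit
  have hσA₀ : σ A₀ = A₀ := by
    refine jE.injective ?_
    rw [← hΘj]
    have h1 : Θ (jE A₀ * ξ₀) = jE A₀ * ξ₀ := by rw [hA₀, map_sub, hΘρ, hΘκ₀]
    rw [map_mul, hΘξ] at h1
    exact mul_right_cancel₀ hξ0 h1
  have hσg : σ (1 + A₀ / V₀) = 1 + A₀ / V₀ := by rw [map_add, map_one, map_div₀, hσA₀, hσV₀]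
  have hg1 : Valued.v (1 + A₀ / V₀) = 1 := by
    have hlt : Valued.v (A₀ / V₀) < Valued.v (1 : E) := by
      rw [Valuation.map_one, ← hjiso, ← hquot, map_div₀, div_lt_one₀ (lt_trans zero_lt_one hW1)]
      refine lt_of_le_of_lt ((Valuation.map_sub _ _ _).trans (max_le hκ₀1.le (by rw [hvρ, hκ₀1]))) hW1
    rw [Valuation.map_add_eq_of_lt_left _ hlt, Valuation.map_one]
  have hnear : Valued.v ((1 + A₀ / V₀) - uE) ≤ Valued.v ϖ ^ (2 * d - 1) := by
    have e : jE ((1 + A₀ / V₀) - uE) = -(u - jE (1 + A₀ / V₀)) := by rw [map_sub, huE]; ring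
    rw [← hjiso, e, Valuation.map_neg, ← hjiso ϖ]; exact hnearM
  have hωu : normSign σ uE = normSign σ (1 + A₀ / V₀) := normSign_eq_of_near hD hσg hσuE hg1 (n := 2 * d - 1) le_rfl hnear
  -- `−1∕(hρh) = ΔΘΔ` and the factorisation `κρκ ∕ (hρh) = u · N_Θ(jE V₀) · N_Θ(ξ₀Δ)`
  set Δ : M := φ (Pi.single 0 1) * ρ (φ (Pi.single 1 1)) - φ (Pi.single 1 1) * ρ (φ (Pi.single 0 1)) with hΔ
  have e1 : h * ρ h * (Δ * Θ Δ) = -1 := normRho_mul_normTheta_lineDisc_eq_neg_one jE φ hΘρ hform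
  have hhh : h * ρ h ≠ 0 := by
    intro h0; rw [h0, zero_mul] at e1; exact one_ne_zero (neg_eq_zero.1 e1.symm)
  have hΔ0 : Δ ≠ 0 := by
    intro h0; rw [h0, zero_mul, mul_zero] at e1; exact one_ne_zero (neg_eq_zero.1 e1.symm)
  have hfac : κ * ρ κ / (h * ρ h) = u * (jE V₀ * Θ (jE V₀)) * ((ξ₀ * Δ) * Θ (ξ₀ * Δ)) := by
    have eκ : κ * ρ κ = -(u * (W * W)) := by rw [hudef, div_mul_cancel₀ _ hW2]; ring
    rw [eκ, div_eq_iff hhh, map_mul, hΘξ, hΘj, hσV₀, hWdef]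
    linear_combination (-(u * (jE V₀ * ξ₀) * (jE V₀ * ξ₀))) * e1
  have hf2 : ∃ e : M, ρ e = e ∧ e * Θ e = jE V₀ * Θ (jE V₀) := ⟨jE V₀, hρj V₀, rfl⟩
  have hf3 : ∃ e : M, ρ e = e ∧ e * Θ e = (ξ₀ * Δ) * Θ (ξ₀ * Δ) :=
    ⟨ξ₀ * Δ, by rw [map_mul, hξ, hΔ, map_lineDisc_eq_neg hρρ, neg_mul_neg], rfl⟩
  have hf20 : jE V₀ * Θ (jE V₀) ≠ 0 := mul_ne_zero hjV0 (by rw [hΘj, hσV₀]; exact hjV0)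
  have hf30 : (ξ₀ * Δ) * Θ (ξ₀ * Δ) ≠ 0 := mul_ne_zero (mul_ne_zero hξ0 hΔ0) ((map_ne_zero Θ).2 (mul_ne_zero hξ0 hΔ0))
  -- the chain `CLASS ↔ u ∈ 𝒩 ↔ uE ∈ N(E^×) ↔ ω(uE) = 1 ↔ ω(1 + A₀∕V₀) = 1`
  rw [hfac, fixedNorm_mul_iff hf30 hf3, fixedNorm_mul_iff hf20 hf2, ← huE, fixedNorm_map_iff jE hjfix hΘj uE,
    ← normSign_eq_one_iff, hωu]

/-! ## §3 The `(q − 2) : q` split of the boundary shell in the digit currency -/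

/-- **THE BOUNDARY SHELL SPLITS `(q − 2) : q` — HYPERBOLIC CLASS.**  Frame of `classClause_iff_normSign_of_boundary` (+ finite residue field, `|2| < 1`) and the ONE chart's digit system:
`Rd` σ-fixed integral representatives modulo `|ϖ|^n` (`hRd1 hRd2 hRd3`), the direction size `|ξ₀| = exp 2N`, the boundary shell exponent `t` with `t + (d − 1) = N`, the resolution
floor `2d + 4t ≤ n + 2N`; a decidability instance for the class conjunct.  THEN, with `S := Rd.filter (|V| = |ϖ|^{2t})` and `q := Nat.card 𝓀[E]`:
**`2(q − 1)·#(S.filter CLASS_h) = (q − 2)·#S`** (§2 digit by digit + FILE A `two_mul_card_filter_normSign_oneAdd_div_eq`).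
[cite: Serre1979, Ch. V §3 Prop. 5, Cor. 2–3 pp. 84–86; Ch. XV §2] [cite: Flicker1998UnitaryFL, Prop. 7 p. 84] [cite: Kottwitz1986BaseChangeUnits, §1 pp. 240–241] -/
theorem two_mul_card_filter_class_boundary [CompleteSpace E] [Finite 𝓀[E]] {σ : E →+* E} {ϖ : E} {d tE : ℕ} (hD : IsRamifiedQuadraticDatum σ ϖ d tE)
    (h2v : Valued.v (2 : E) < 1) (hd : 2 ≤ d)
    (jE : E →+* M) (hjfix : ∀ z, ρ z = z ↔ ∃ c, jE c = z) (hΘj : ∀ c, Θ (jE c) = jE (σ c)) (hjiso : ∀ a, Valued.v (jE a) = Valued.v a)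
    (hρρ : ∀ x, ρ (ρ x) = x) (hvρ : ∀ x, Valued.v (ρ x) = Valued.v x) (hΘρ : ∀ x, Θ (ρ x) = ρ (Θ x))
    (φ : (Fin 2 → E) →+ M) {h : M} (hform : ∀ x y, jE (pairing σ ((StdForm.antidiagonal 2).over E) x y) = h * Θ (φ x) * φ y + ρ (h * Θ (φ x) * φ y))
    {κ₀ ξ₀ : M} (hκ₀ : κ₀ + ρ κ₀ = 1) (hΘκ₀ : Θ κ₀ = κ₀) (hκ₀1 : Valued.v κ₀ = 1) (hξ : ρ ξ₀ = -ξ₀) (hΘξ : Θ ξ₀ = ξ₀)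
    {N : ℕ} (hξN : Valued.v ξ₀ = exp (2 * (N : ℤ))) {A₀ : E} (hA₀ : jE A₀ * ξ₀ = κ₀ - ρ κ₀)
    (Rd : Finset E) {n : ℕ} (hRd1 : ∀ V ∈ Rd, σ V = V ∧ Valued.v V ≤ 1)
    (hRd2 : ∀ V : E, σ V = V → Valued.v V ≤ 1 → ∃ V₀ ∈ Rd, Valued.v (V - V₀) ≤ Valued.v ϖ ^ n)
    (hRd3 : ∀ V ∈ Rd, ∀ V' ∈ Rd, Valued.v (V - V') ≤ Valued.v ϖ ^ n → V = V')
    (t : ℕ) (htN : t + (d - 1) = N) (hres : 2 * d + 4 * t ≤ n + 2 * N)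
    [DecidablePred fun V : E => ∃ e : M, ρ e = e ∧ e * Θ e = (κ₀ + jE V * ξ₀) * ρ (κ₀ + jE V * ξ₀) / (h * ρ h)] :
    2 * ((Nat.card 𝓀[E] : ℤ) - 1) *
        (((Rd.filter fun V => Valued.v V = Valued.v ϖ ^ (2 * t)).filter fun V => ∃ e : M, ρ e = e ∧ e * Θ e = (κ₀ + jE V * ξ₀) * ρ (κ₀ + jE V * ξ₀) / (h * ρ h)).card : ℤ) =
      ((Nat.card 𝓀[E] : ℤ) - 2) * ((Rd.filter fun V => Valued.v V = Valued.v ϖ ^ (2 * t)).card : ℤ) := by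
  obtain ⟨-, -, hϖ, -, -, -, -⟩ := id hD
  have hξ0 : ξ₀ ≠ 0 := fun h0 => by rw [h0, Valuation.map_zero] at hξN; exact exp_ne_zero hξN.symm
  obtain ⟨hσA₀, hAξ⟩ := slope_letters jE hΘj hjiso hΘρ h2v hκ₀ hΘκ₀ hκ₀1 hΘξ hξ0 hA₀
  have hvA₀ : Valued.v A₀ = Valued.v ϖ ^ (2 * N) := v_slope_eq hϖ hξN hAξ
  -- on the shell `|V| = |ϖ|^{2t}` the class conjunct is `ω(1 + A₀∕V) = 1`
  have hread : ∀ V ∈ Rd.filter (fun V => Valued.v V = Valued.v ϖ ^ (2 * t)),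
      (∃ e : M, ρ e = e ∧ e * Θ e = (κ₀ + jE V * ξ₀) * ρ (κ₀ + jE V * ξ₀) / (h * ρ h)) ↔ normSign σ (1 + A₀ / V) = 1 := by
    intro V hV
    obtain ⟨hVR, hvV⟩ := mem_filter.1 hV
    refine classClause_iff_normSign_of_boundary hD hd jE hjfix hΘj hjiso hρρ hvρ hΘρ φ hform hΘκ₀ hκ₀1 hξ hΘξ hA₀ (hRd1 V hVR).1 ?_
    rw [hvV, hξN, v_varpi_pow hϖ, ← exp_add]; congr 1; push_cast; omega
  rw [filter_congr hread]
  exact (two_mul_card_filter_normSign_oneAdd_div_eq hD h2v hd Rd hRd1 hRd2 hRd3 t hσA₀ hvA₀ (by omega) (by omega)).1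

/-- **THE BOUNDARY SHELL SPLITS `(q − 2) : q` — ANISOTROPIC CLASS.**  Frame of `two_mul_card_filter_class_boundary` plus the CORE frame of ★ `classClause_iff_not_classClause` (the
frame equation `_hA` with `η ∉ N(E^×)`, the A-literal's line model `(φ′, h′)` of `Matrix.diagonal dg`, `Θh = h ≠ 0`, `Θh′ = h′ ≠ 0`) and a decidability instance for the A-class conjunct.
THEN **`2(q − 1)·#(S.filter CLASS_{h′}) = q·#S`** (`CLASS_{h′} ↔ ¬CLASS_h ↔ ω(1 + A₀∕V) ≠ 1` digit by digit + FILE A).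
[cite: Serre1979, Ch. V §3 Prop. 5, Cor. 2–3 pp. 84–86; Ch. XV §2] [cite: Jacobowitz1962, §3] [cite: Flicker1998UnitaryFL, Prop. 7 p. 84] [cite: Kottwitz1986BaseChangeUnits, §1 pp. 240–241] -/
theorem two_mul_card_filter_class'_boundary [CompleteSpace E] [Finite 𝓀[E]] {σ : E →+* E} {ϖ : E} {d tE : ℕ} (hD : IsRamifiedQuadraticDatum σ ϖ d tE)
    (h2v : Valued.v (2 : E) < 1) (hd : 2 ≤ d)
    (jE : E →+* M) (hjfix : ∀ z, ρ z = z ↔ ∃ c, jE c = z) (hΘj : ∀ c, Θ (jE c) = jE (σ c)) (hjiso : ∀ a, Valued.v (jE a) = Valued.v a)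
    (hρρ : ∀ x, ρ (ρ x) = x) (hvρ : ∀ x, Valued.v (ρ x) = Valued.v x) (hΘρ : ∀ x, Θ (ρ x) = ρ (Θ x))
    (P₁ : GL (Fin 3) E) (dg : Fin 2 → E) (η : E)
    (hA : formCongr σ P₁ ((StdForm.antidiagonal 3).over E) =
      (!![(Matrix.diagonal dg) 0 0, 0, (Matrix.diagonal dg) 0 1; 0, η, 0; (Matrix.diagonal dg) 1 0, 0, (Matrix.diagonal dg) 1 1] : Matrix (Fin 3) (Fin 3) E))
    (hηN : ¬ ∃ t : E, t * σ t = η)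
    (φ : (Fin 2 → E) →+ M) {h : M} (hform : ∀ x y, jE (pairing σ ((StdForm.antidiagonal 2).over E) x y) = h * Θ (φ x) * φ y + ρ (h * Θ (φ x) * φ y))
    (hΘh : Θ h = h) (hh : h ≠ 0)
    (φ' : (Fin 2 → E) →+ M) {h' : M} (hform' : ∀ x y, jE (pairing σ (Matrix.diagonal dg) x y) = h' * Θ (φ' x) * φ' y + ρ (h' * Θ (φ' x) * φ' y))
    (hΘh' : Θ h' = h') (hh' : h' ≠ 0)
    {κ₀ ξ₀ : M} (hκ₀ : κ₀ + ρ κ₀ = 1) (hΘκ₀ : Θ κ₀ = κ₀) (hκ₀1 : Valued.v κ₀ = 1) (hξ : ρ ξ₀ = -ξ₀) (hΘξ : Θ ξ₀ = ξ₀)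
    {N : ℕ} (hξN : Valued.v ξ₀ = exp (2 * (N : ℤ))) {A₀ : E} (hA₀ : jE A₀ * ξ₀ = κ₀ - ρ κ₀)
    (Rd : Finset E) {n : ℕ} (hRd1 : ∀ V ∈ Rd, σ V = V ∧ Valued.v V ≤ 1)
    (hRd2 : ∀ V : E, σ V = V → Valued.v V ≤ 1 → ∃ V₀ ∈ Rd, Valued.v (V - V₀) ≤ Valued.v ϖ ^ n)
    (hRd3 : ∀ V ∈ Rd, ∀ V' ∈ Rd, Valued.v (V - V') ≤ Valued.v ϖ ^ n → V = V')
    (t : ℕ) (htN : t + (d - 1) = N) (hres : 2 * d + 4 * t ≤ n + 2 * N)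
    [DecidablePred fun V : E => ∃ e : M, ρ e = e ∧ e * Θ e = (κ₀ + jE V * ξ₀) * ρ (κ₀ + jE V * ξ₀) / (h' * ρ h')] :
    2 * ((Nat.card 𝓀[E] : ℤ) - 1) *
        (((Rd.filter fun V => Valued.v V = Valued.v ϖ ^ (2 * t)).filter fun V => ∃ e : M, ρ e = e ∧ e * Θ e = (κ₀ + jE V * ξ₀) * ρ (κ₀ + jE V * ξ₀) / (h' * ρ h')).card : ℤ) =
      (Nat.card 𝓀[E] : ℤ) * ((Rd.filter fun V => Valued.v V = Valued.v ϖ ^ (2 * t)).card : ℤ) := by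
  obtain ⟨-, -, hϖ, -, -, -, -⟩ := id hD
  have hξ0 : ξ₀ ≠ 0 := fun h0 => by rw [h0, Valuation.map_zero] at hξN; exact exp_ne_zero hξN.symm
  obtain ⟨hσA₀, hAξ⟩ := slope_letters jE hΘj hjiso hΘρ h2v hκ₀ hΘκ₀ hκ₀1 hΘξ hξ0 hA₀
  have hvA₀ : Valued.v A₀ = Valued.v ϖ ^ (2 * N) := v_slope_eq hϖ hξN hAξ
  have hread : ∀ V ∈ Rd.filter (fun V => Valued.v V = Valued.v ϖ ^ (2 * t)),
      (∃ e : M, ρ e = e ∧ e * Θ e = (κ₀ + jE V * ξ₀) * ρ (κ₀ + jE V * ξ₀) / (h' * ρ h')) ↔ ¬ normSign σ (1 + A₀ / V) = 1 := by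
    intro V hV
    obtain ⟨hVR, hvV⟩ := mem_filter.1 hV
    rw [classClause_iff_not_classClause hD jE hjfix hΘj hρρ hΘρ P₁ dg η hA hηN φ hform hΘh hh φ' hform' hΘh' hh' hκ₀ hΘκ₀ hξ hΘξ (hRd1 V hVR).1,
      classClause_iff_normSign_of_boundary hD hd jE hjfix hΘj hjiso hρρ hvρ hΘρ φ hform hΘκ₀ hκ₀1 hξ hΘξ hA₀ (hRd1 V hVR).1]
    rw [hvV, hξN, v_varpi_pow hϖ, ← exp_add]; congr 1; push_cast; omega
  rw [filter_congr hread]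
  exact (two_mul_card_filter_normSign_oneAdd_div_eq hD h2v hd Rd hRd1 hRd2 hRd3 t hσA₀ hvA₀ (by omega) (by omega)).2

/-- **THE `hLBd` DRESS** (★ `…UniformDensityFromTables.crossDensity_of_tables`' boundary letter): if `#shell = (q − 1)·T` (★ (d″-T) `card_filter_shell_eq_mul_card_ball` gives
`T = q^{d−2}·β` at `i = d − 1`) and the two literal counts `L_H, L_A` satisfy this file's splits `2(q−1)·L_H = (q−2)·#shell`, `2(q−1)·L_A = q·#shell`, then — `q ≥ 2` for a finite
residue FIELD — **`2·L_H = (q − 2)·T ∧ 2·L_A = q·T`**. [cite: Kottwitz1986BaseChangeUnits, §1 pp. 240–241] [cite: Flicker1998UnitaryFL, Prop. 7 p. 84] -/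
theorem hLBd_of_boundary [Finite 𝓀[E]] {S LH LA T : ℤ} (hT : S = ((Nat.card 𝓀[E] : ℤ) - 1) * T)
    (hH : 2 * ((Nat.card 𝓀[E] : ℤ) - 1) * LH = ((Nat.card 𝓀[E] : ℤ) - 2) * S) (hA' : 2 * ((Nat.card 𝓀[E] : ℤ) - 1) * LA = (Nat.card 𝓀[E] : ℤ) * S) :
    2 * LH = ((Nat.card 𝓀[E] : ℤ) - 2) * T ∧ 2 * LA = (Nat.card 𝓀[E] : ℤ) * T := by
  have hq : ((Nat.card 𝓀[E] : ℤ) - 1) ≠ 0 := by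
    have h1 : 1 < Nat.card 𝓀[E] := Finite.one_lt_card
    omega
  rw [hT] at hH hA'
  constructor
  · refine mul_left_cancel₀ hq ?_; linear_combination hH
  · refine mul_left_cancel₀ hq ?_; linear_combination hA'

end Summit.HodgeConjecture.HodgeConjecture.Cruxes.H413.F0P3cDyRamRowCellDigitClassBoundary

end
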